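import Summits.Parity.GeneralizedHardyLittlewood.Theorems.ChenParityOracleBLAPHostParityFromBrickPrimeHostLevel
import HarnessLib

/-!
# Route `ChenParityOracleBLAP` — crux S1 = `HostParityFromBrick` (stmt-Parity-20045): the prime half, eventual form

Support file for the prime half `K1 → K2 → HP1` of S1 (step (F2)): the elementary thresholds
(`prime_thresholds`, all eventually true), the numeric envelope of the level bound of
`level_sum_le_all_heights` (`level_envelope_le`), and the final numeric inequality
`4·Senv(x) + 8x^{1−ε} log x ≤ η x/(log x)²` under the thresholds (`final_numeric_le`).

References: H. Iwaniec, E. Kowalski, *Analytic Number Theory* (2004), §13.4, §17.3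
[IwaniecKowalski2004].
-/

namespace Summit.Parity.GeneralizedHardyLittlewood.Theorems

open Finset Real Filter
open ArithmeticFunction
open scoped ArithmeticFunction.sigma

/-- `log₂ t + 1 ≤ 3 log x` for `1 ≤ t ≤ x`, `e ≤ x`. -/
theorem natlog2_succ_le {t x : ℕ} (htx : t ≤ x) (hL : 1 ≤ Real.log x) :
    ((Nat.log 2 t + 1 : ℕ) : ℝ) ≤ 3 * Real.log x := by
  have hlog2 : (1 : ℝ) / 2 < Real.log 2 := by
    have := Real.log_two_gt_d9; linarith
  rcases Nat.eq_zero_or_pos t with rfl | ht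
  · simp; linarith
  have h1 : (2 : ℝ) ^ (Nat.log 2 t) ≤ t := by exact_mod_cast Nat.pow_log_le_self 2 ht.ne'
  have h2 : (Nat.log 2 t : ℝ) * Real.log 2 ≤ Real.log x := by
    have := Real.log_le_log (by positivity) h1
    rw [Real.log_pow] at this
    exact this.trans (Real.log_le_log (by exact_mod_cast ht) (by exact_mod_cast htx))
  have h3 : (Nat.log 2 t : ℝ) ≤ 2 * Real.log x := by
    have h0 : (0 : ℝ) ≤ Nat.log 2 t := Nat.cast_nonneg _
    nlinarith
  push_cast; linarith

/-- `(log x)^r ≤ c x^s` eventually (`s, c > 0`). -/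
theorem log_pow_le_rpow_eventually (r : ℕ) {s : ℝ} (hs : 0 < s) {c : ℝ} (hc : 0 < c) :
    ∀ᶠ x : ℝ in atTop, Real.log x ^ r ≤ c * x ^ s := by
  have h := (isLittleO_log_rpow_rpow_atTop (r : ℝ) hs).bound hc
  filter_upwards [h, eventually_ge_atTop (1 : ℝ)] with x hx hx1
  have hl : 0 ≤ Real.log x := Real.log_nonneg hx1
  rw [Real.norm_of_nonneg (Real.rpow_nonneg hl _), Real.norm_of_nonneg (Real.rpow_nonneg (by linarith) _),
    Real.rpow_natCast] at hx
  exact hx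

/-- The elementary thresholds of the prime half (all eventually true in `x`). -/
theorem prime_thresholds {δ ε : ℝ} (hδ0 : 0 < δ) (hε : 0 < ε) (c K : ℝ) (hK : 0 ≤ K) :
    ∀ᶠ x : ℕ in atTop, (16 : ℝ) ≤ x ∧ 3 ≤ Real.log x ∧
      2 * c + 1 ≤ Real.log x / Real.log (Real.log x) ∧ 8 ≤ Real.log (Real.log x) ∧
      2 ≤ (x : ℝ) ^ (1 / 8 : ℝ) ∧ 5 ≤ (x : ℝ) ^ (δ / 2) ∧ K ≤ Real.log x ∧
      K * Real.log x ^ 15 ≤ (x : ℝ) ^ (δ / 2) ∧ K * Real.log x ^ 3 ≤ (x : ℝ) ^ ε := by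
  have hlog := Real.tendsto_log_atTop
  have hll := hlog.comp hlog
  have F1 : ∀ᶠ x : ℝ in atTop, (16 : ℝ) ≤ x := eventually_ge_atTop _
  have F2 : ∀ᶠ x : ℝ in atTop, 3 ≤ Real.log x := hlog.eventually_ge_atTop _
  have F3 : ∀ᶠ x : ℝ in atTop, 2 * c + 1 ≤ Real.log x / Real.log (Real.log x) := by
    have hpos : (0 : ℝ) < 1 / (2 * |c| + 2) := by positivity
    have h := (Real.isLittleO_log_id_atTop.comp_tendsto hlog).bound hpos
    filter_upwards [h, hll.eventually_ge_atTop (1 : ℝ), hlog.eventually_ge_atTop (1 : ℝ)]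
      with x hx hll1 hl1
    have hx' : |Real.log (Real.log x)| ≤ 1 / (2 * |c| + 2) * |Real.log x| := by
      simpa only [Function.comp_def, id, Real.norm_eq_abs] using hx
    have hll1' : (1 : ℝ) ≤ Real.log (Real.log x) := by simpa [Function.comp_def] using hll1
    rw [abs_of_nonneg (show (0 : ℝ) ≤ Real.log (Real.log x) by linarith),
      abs_of_nonneg (show (0 : ℝ) ≤ Real.log x by linarith)] at hx'
    rw [le_div_iff₀ (by linarith)]
    have h1 : (2 * |c| + 2) * Real.log (Real.log x) ≤ Real.log x := by
      have := mul_le_mul_of_nonneg_left hx' (by positivity : (0 : ℝ) ≤ 2 * |c| + 2)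
      rw [← mul_assoc, mul_one_div_cancel (by positivity), one_mul] at this
      exact this
    nlinarith [le_abs_self c]
  have F4 : ∀ᶠ x : ℝ in atTop, 8 ≤ Real.log (Real.log x) := by
    filter_upwards [hll.eventually_ge_atTop (8 : ℝ)] with x hx
    simpa [Function.comp_def] using hx
  have F5 : ∀ᶠ x : ℝ in atTop, 2 ≤ x ^ (1 / 8 : ℝ) :=
    (tendsto_rpow_atTop (by norm_num)).eventually_ge_atTop _
  have F6 : ∀ᶠ x : ℝ in atTop, 5 ≤ x ^ (δ / 2) :=
    (tendsto_rpow_atTop (by positivity)).eventually_ge_atTop _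
  have F7 : ∀ᶠ x : ℝ in atTop, K ≤ Real.log x := hlog.eventually_ge_atTop _
  have F8 : ∀ᶠ x : ℝ in atTop, K * Real.log x ^ 15 ≤ x ^ (δ / 2) := by
    filter_upwards [log_pow_le_rpow_eventually 15 (by positivity : 0 < δ / 2)
      (by positivity : (0 : ℝ) < 1 / (K + 1)), eventually_ge_atTop (0 : ℝ)] with x hx hx0
    have h0 : 0 ≤ x ^ (δ / 2) := Real.rpow_nonneg hx0 _
    have := mul_le_mul_of_nonneg_left hx hK
    have h2 : K * (1 / (K + 1) * x ^ (δ / 2)) ≤ x ^ (δ / 2) := by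
      rw [← mul_assoc]
      have : K * (1 / (K + 1)) ≤ 1 := by
        rw [mul_one_div, div_le_one (by linarith)]; linarith
      nlinarith
    linarith
  have F9 : ∀ᶠ x : ℝ in atTop, K * Real.log x ^ 3 ≤ x ^ ε := by
    filter_upwards [log_pow_le_rpow_eventually 3 hε (by positivity : (0 : ℝ) < 1 / (K + 1)),
      eventually_ge_atTop (0 : ℝ)] with x hx hx0
    have h0 : 0 ≤ x ^ ε := Real.rpow_nonneg hx0 _
    have := mul_le_mul_of_nonneg_left hx hK
    have h2 : K * (1 / (K + 1) * x ^ ε) ≤ x ^ ε := by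
      rw [← mul_assoc]
      have : K * (1 / (K + 1)) ≤ 1 := by
        rw [mul_one_div, div_le_one (by linarith)]; linarith
      nlinarith
    linarith
  have E := (F1.and F2).and ((F3.and F4).and ((F5.and F6).and ((F7.and F8).and F9)))
  have EN := tendsto_natCast_atTop_atTop.eventually E
  filter_upwards [EN] with x hx
  obtain ⟨⟨h1, h2⟩, ⟨h3, h4⟩, ⟨h5, h6⟩, ⟨h7, h8⟩, h9⟩ := hx
  exact ⟨h1, h2, h3, h4, h5, h6, h7, h8, h9⟩

/-- Numeric envelope: the explicit `S*(x)` of `level_sum_le_all_heights` is at most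
`Senv(x) = 6x^{2/3}L² + 6x^{5/6} + 3x^{3/4}L² + 4x/L^9 + 405x/L^{15} + 9K₀x/L^4 + 9K₀x^{1−δ/2}L^{13} + 3x^{1/2}L`
(`L = log x`, `K₀ = 2^{14}√(C_τ+1)`), given `U ≤ x^{1/3}`, `U² ≤ x`, `N ≤ x^{1/4}`, `2 ≤ x^{2/3}`, `1 ≤ L`. -/
theorem level_envelope_le {x U N : ℕ} {δ ε Cτ : ℝ} (hx : (16 : ℝ) ≤ x) (hL1 : 1 ≤ Real.log x)
    (hε : 0 ≤ ε) (hCτ : 0 ≤ Cτ) (hUx : (U : ℝ) ≤ (x : ℝ) ^ (1 / 3 : ℝ)) (hUUx : U * U ≤ x)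
    (hNx : (N : ℝ) ≤ (x : ℝ) ^ (1 / 4 : ℝ)) (hx23 : 2 ≤ (x : ℝ) ^ (2 / 3 : ℝ)) :
    Real.log x * (((x : ℝ) ^ (2 / 3 : ℝ) + 2) * (1 + 2 * Real.log x)) +
      (⌊(x : ℝ) ^ (1 / 2 - ε)⌋₊ : ℝ) * (6 * U + (N : ℝ) * (Nat.log 2 x + 1 : ℕ) * Real.log x) +
      4 * Real.log x * ((x : ℝ) / Real.log x ^ (10 : ℝ)) +
      ((Nat.log 2 (U * U) + 1 : ℕ) : ℝ) * (Real.log x *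
        (45 * (x : ℝ) / Real.log x ^ (18 : ℝ) + 2 ^ (14 : ℕ) * Real.sqrt (Cτ + 1) *
          ((x : ℝ) / Real.log x ^ (7 : ℝ) + (x : ℝ) ^ (1 - δ / 2) * Real.log x ^ (10 : ℝ)))) +
      2 * ((Nat.log 2 x + 1 : ℕ) : ℝ) * (Real.log x ^ 2 *
        (45 * (x : ℝ) / Real.log x ^ (18 : ℝ) + 2 ^ (14 : ℕ) * Real.sqrt (Cτ + 1) *
          ((x : ℝ) / Real.log x ^ (7 : ℝ) + (x : ℝ) ^ (1 - δ / 2) * Real.log x ^ (10 : ℝ)))) +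
      (⌊(x : ℝ) ^ (1 / 2 - ε)⌋₊ : ℝ) * ((Nat.log 2 x + 1 : ℕ) : ℝ) ≤
    6 * (x : ℝ) ^ (2 / 3 : ℝ) * Real.log x ^ 2 + 6 * (x : ℝ) ^ (5 / 6 : ℝ) +
      3 * (x : ℝ) ^ (3 / 4 : ℝ) * Real.log x ^ 2 + 4 * (x : ℝ) / Real.log x ^ (9 : ℝ) +
      405 * (x : ℝ) / Real.log x ^ (15 : ℝ) +
      9 * (2 ^ (14 : ℕ) * Real.sqrt (Cτ + 1)) * ((x : ℝ) / Real.log x ^ (4 : ℝ)) +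
      9 * (2 ^ (14 : ℕ) * Real.sqrt (Cτ + 1)) * ((x : ℝ) ^ (1 - δ / 2) * Real.log x ^ (13 : ℝ)) +
      3 * (x : ℝ) ^ (1 / 2 : ℝ) * Real.log x := by
  have hx0 : (0 : ℝ) < x := by linarith
  have hx1 : (1 : ℝ) ≤ x := by linarith
  have hL0 : 0 < Real.log x := by linarith
  have hxN : 1 ≤ x := by exact_mod_cast hx1
  -- generic facts
  have hlg : ((Nat.log 2 x + 1 : ℕ) : ℝ) ≤ 3 * Real.log x := natlog2_succ_le le_rfl hL1
  have hlgU : ((Nat.log 2 (U * U) + 1 : ℕ) : ℝ) ≤ 3 * Real.log x := natlog2_succ_le hUUx hL1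
  have hD : (⌊(x : ℝ) ^ (1 / 2 - ε)⌋₊ : ℝ) ≤ (x : ℝ) ^ (1 / 2 : ℝ) :=
    (Nat.floor_le (by positivity)).trans (Real.rpow_le_rpow_of_exponent_le hx1 (by linarith))
  set X₂ : ℝ := 45 * (x : ℝ) / Real.log x ^ (18 : ℝ) + 2 ^ (14 : ℕ) * Real.sqrt (Cτ + 1) *
    ((x : ℝ) / Real.log x ^ (7 : ℝ) + (x : ℝ) ^ (1 - δ / 2) * Real.log x ^ (10 : ℝ)) with hX₂
  have hX₂0 : 0 ≤ X₂ := by positivity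
  -- (a)
  have ha : Real.log x * (((x : ℝ) ^ (2 / 3 : ℝ) + 2) * (1 + 2 * Real.log x)) ≤
      6 * (x : ℝ) ^ (2 / 3 : ℝ) * Real.log x ^ 2 := by
    have h1 : (x : ℝ) ^ (2 / 3 : ℝ) + 2 ≤ 2 * (x : ℝ) ^ (2 / 3 : ℝ) := by linarith
    have h2 : 1 + 2 * Real.log x ≤ 3 * Real.log x := by linarith
    have h3 : ((x : ℝ) ^ (2 / 3 : ℝ) + 2) * (1 + 2 * Real.log x) ≤
        2 * (x : ℝ) ^ (2 / 3 : ℝ) * (3 * Real.log x) :=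
      mul_le_mul h1 h2 (by positivity) (by positivity)
    nlinarith [mul_le_mul_of_nonneg_left h3 hL0.le]
  -- (b)
  have hb : (⌊(x : ℝ) ^ (1 / 2 - ε)⌋₊ : ℝ) * (6 * U + (N : ℝ) * (Nat.log 2 x + 1 : ℕ) * Real.log x) ≤
      6 * (x : ℝ) ^ (5 / 6 : ℝ) + 3 * (x : ℝ) ^ (3 / 4 : ℝ) * Real.log x ^ 2 := by
    have h1 : 6 * (U : ℝ) + (N : ℝ) * (Nat.log 2 x + 1 : ℕ) * Real.log x ≤
        6 * (x : ℝ) ^ (1 / 3 : ℝ) + (x : ℝ) ^ (1 / 4 : ℝ) * (3 * Real.log x) * Real.log x := by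
      have := mul_le_mul hNx hlg (Nat.cast_nonneg _) (by positivity)
      nlinarith [mul_le_mul_of_nonneg_right this hL0.le]
    have h2 := mul_le_mul hD h1 (by positivity) (by positivity)
    refine h2.trans (le_of_eq ?_)
    have e1 : (x : ℝ) ^ (1 / 2 : ℝ) * (x : ℝ) ^ (1 / 3 : ℝ) = (x : ℝ) ^ (5 / 6 : ℝ) := by
      rw [← Real.rpow_add hx0]; norm_num
    have e2 : (x : ℝ) ^ (1 / 2 : ℝ) * (x : ℝ) ^ (1 / 4 : ℝ) = (x : ℝ) ^ (3 / 4 : ℝ) := by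
      rw [← Real.rpow_add hx0]; norm_num
    calc (x : ℝ) ^ (1 / 2 : ℝ) * (6 * (x : ℝ) ^ (1 / 3 : ℝ) + (x : ℝ) ^ (1 / 4 : ℝ) * (3 * Real.log x) * Real.log x)
        = 6 * ((x : ℝ) ^ (1 / 2 : ℝ) * (x : ℝ) ^ (1 / 3 : ℝ)) +
          3 * ((x : ℝ) ^ (1 / 2 : ℝ) * (x : ℝ) ^ (1 / 4 : ℝ)) * Real.log x ^ 2 := by ring
      _ = _ := by rw [e1, e2]
  -- (c)
  have hc : 4 * Real.log x * ((x : ℝ) / Real.log x ^ (10 : ℝ)) = 4 * (x : ℝ) / Real.log x ^ (9 : ℝ) := by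
    have e : Real.log x ^ (10 : ℝ) = Real.log x ^ (9 : ℝ) * Real.log x := by
      rw [show (10 : ℝ) = 9 + 1 by norm_num, Real.rpow_add hL0, Real.rpow_one]
    rw [e]; field_simp
  -- (d) + (e)
  have hde : ((Nat.log 2 (U * U) + 1 : ℕ) : ℝ) * (Real.log x * X₂) +
      2 * ((Nat.log 2 x + 1 : ℕ) : ℝ) * (Real.log x ^ 2 * X₂) ≤ 9 * (Real.log x ^ 3 * X₂) := by
    have h1 : ((Nat.log 2 (U * U) + 1 : ℕ) : ℝ) * (Real.log x * X₂) ≤ 3 * Real.log x * (Real.log x * X₂) :=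
      mul_le_mul_of_nonneg_right hlgU (by positivity)
    have h2 : 2 * ((Nat.log 2 x + 1 : ℕ) : ℝ) * (Real.log x ^ 2 * X₂) ≤
        2 * (3 * Real.log x) * (Real.log x ^ 2 * X₂) := by
      have := mul_le_mul_of_nonneg_right hlg (by positivity : 0 ≤ Real.log x ^ 2 * X₂)
      nlinarith
    have h3 : 3 * Real.log x * (Real.log x * X₂) ≤ 3 * (Real.log x ^ 3 * X₂) := by
      have h := mul_le_mul_of_nonneg_right hL1 (by positivity : 0 ≤ Real.log x ^ 2 * X₂)
      have e1 : 3 * Real.log x * (Real.log x * X₂) = 3 * (1 * (Real.log x ^ 2 * X₂)) := by ring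
      have e2 : 3 * (Real.log x ^ 3 * X₂) = 3 * (Real.log x * (Real.log x ^ 2 * X₂)) := by ring
      rw [e1, e2]
      linarith
    have e : 2 * (3 * Real.log x) * (Real.log x ^ 2 * X₂) = 6 * (Real.log x ^ 3 * X₂) := by ring
    linarith [h1, h2, h3, e]
  have h9 : 9 * (Real.log x ^ 3 * X₂) = 405 * (x : ℝ) / Real.log x ^ (15 : ℝ) +
      9 * (2 ^ (14 : ℕ) * Real.sqrt (Cτ + 1)) * ((x : ℝ) / Real.log x ^ (4 : ℝ)) +
      9 * (2 ^ (14 : ℕ) * Real.sqrt (Cτ + 1)) * ((x : ℝ) ^ (1 - δ / 2) * Real.log x ^ (13 : ℝ)) := by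
    have e3 : Real.log x ^ 3 = Real.log x ^ (3 : ℝ) := by
      rw [show (3 : ℝ) = ((3 : ℕ) : ℝ) by norm_num, Real.rpow_natCast]
    have e18 : Real.log x ^ (18 : ℝ) = Real.log x ^ (3 : ℝ) * Real.log x ^ (15 : ℝ) := by
      rw [← Real.rpow_add hL0]; norm_num
    have e7 : Real.log x ^ (7 : ℝ) = Real.log x ^ (3 : ℝ) * Real.log x ^ (4 : ℝ) := by
      rw [← Real.rpow_add hL0]; norm_num
    have e13 : Real.log x ^ (13 : ℝ) = Real.log x ^ (3 : ℝ) * Real.log x ^ (10 : ℝ) := by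
      rw [← Real.rpow_add hL0]; norm_num
    have h3 : Real.log x ^ (3 : ℝ) ≠ 0 := (Real.rpow_pos_of_pos hL0 _).ne'
    have h15 : Real.log x ^ (15 : ℝ) ≠ 0 := (Real.rpow_pos_of_pos hL0 _).ne'
    have h4 : Real.log x ^ (4 : ℝ) ≠ 0 := (Real.rpow_pos_of_pos hL0 _).ne'
    rw [hX₂, e3, e18, e7, e13]
    field_simp
    ring
  -- (f)
  have hf : (⌊(x : ℝ) ^ (1 / 2 - ε)⌋₊ : ℝ) * ((Nat.log 2 x + 1 : ℕ) : ℝ) ≤ 3 * (x : ℝ) ^ (1 / 2 : ℝ) * Real.log x := by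
    have := mul_le_mul hD hlg (Nat.cast_nonneg _) (by positivity)
    linarith
  linarith [ha, hb, hc, hde, h9, hf]

/-- The final numeric inequality of the prime half: with `L = log x ≥ 1`, `K₀ = 2^{14}√(C_τ+1)`,
`K_η = 16200 + 360K₀ + 240` and the thresholds `K_η ≤ ηL`, `K_η L^{15} ≤ η x^{δ/2}`,
`K_η L^3 ≤ η x^ε` (`0 < δ ≤ 1/12`): `4·Senv(x) + 8x^{1−ε}L ≤ η x/L²`. -/
theorem final_numeric_le {x : ℕ} {δ ε η Cτ : ℝ} (hx : (16 : ℝ) ≤ x) (hL1 : 1 ≤ Real.log x)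
    (hη : 0 < η) (hδ0 : 0 < δ) (hδ1 : δ ≤ 1 / 12) (hCτ : 0 ≤ Cτ)
    (hKL : (16200 + 360 * (2 ^ (14 : ℕ) * Real.sqrt (Cτ + 1)) + 240) ≤ η * Real.log x)
    (hKpow : (16200 + 360 * (2 ^ (14 : ℕ) * Real.sqrt (Cτ + 1)) + 240) * Real.log x ^ 15 ≤
      η * (x : ℝ) ^ (δ / 2))
    (hKε : (16200 + 360 * (2 ^ (14 : ℕ) * Real.sqrt (Cτ + 1)) + 240) * Real.log x ^ 3 ≤
      η * (x : ℝ) ^ ε) :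
    4 * (6 * (x : ℝ) ^ (2 / 3 : ℝ) * Real.log x ^ 2 + 6 * (x : ℝ) ^ (5 / 6 : ℝ) +
      3 * (x : ℝ) ^ (3 / 4 : ℝ) * Real.log x ^ 2 + 4 * (x : ℝ) / Real.log x ^ (9 : ℝ) +
      405 * (x : ℝ) / Real.log x ^ (15 : ℝ) +
      9 * (2 ^ (14 : ℕ) * Real.sqrt (Cτ + 1)) * ((x : ℝ) / Real.log x ^ (4 : ℝ)) +
      9 * (2 ^ (14 : ℕ) * Real.sqrt (Cτ + 1)) * ((x : ℝ) ^ (1 - δ / 2) * Real.log x ^ (13 : ℝ)) +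
      3 * (x : ℝ) ^ (1 / 2 : ℝ) * Real.log x) + 8 * (x : ℝ) ^ (1 - ε) * Real.log x ≤
    η * (x : ℝ) / Real.log x ^ 2 := by
  have hx0 : (0 : ℝ) < x := by linarith
  have hx1 : (1 : ℝ) ≤ x := by linarith
  set L : ℝ := Real.log x with hL
  set K₀ : ℝ := 2 ^ (14 : ℕ) * Real.sqrt (Cτ + 1) with hK₀
  have hK₀0 : 0 ≤ K₀ := by positivity
  have hL0 : 0 < L := by linarith
  -- rpow ↔ pow conversions
  have eL : ∀ n : ℕ, L ^ ((n : ℕ) : ℝ) = L ^ n := fun n => Real.rpow_natCast L n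
  have e9 : L ^ (9 : ℝ) = L ^ 9 := by rw [← eL 9]; norm_num
  have e15 : L ^ (15 : ℝ) = L ^ 15 := by rw [← eL 15]; norm_num
  have e4 : L ^ (4 : ℝ) = L ^ 4 := by rw [← eL 4]; norm_num
  have e13 : L ^ (13 : ℝ) = L ^ 13 := by rw [← eL 13]; norm_num
  rw [e9, e15, e4, e13]
  -- powers of `L`
  have hLp : ∀ {m n : ℕ}, m ≤ n → L ^ m ≤ L ^ n := fun h => pow_le_pow_right₀ hL1 h
  have hL2 : 0 < L ^ 2 := by positivity
  -- splitting `x`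
  have hsplit : ∀ a : ℝ, (x : ℝ) = (x : ℝ) ^ a * (x : ℝ) ^ (1 - a) := by
    intro a; rw [← Real.rpow_add hx0]; norm_num
  have hmono : ∀ {a b : ℝ}, a ≤ b → (x : ℝ) ^ a ≤ (x : ℝ) ^ b :=
    fun h => Real.rpow_le_rpow_of_exponent_le hx1 h
  have hxδ3 : (x : ℝ) ^ (δ / 2) ≤ (x : ℝ) ^ (1 - 2 / 3 : ℝ) := hmono (by linarith)
  have hxδ6 : (x : ℝ) ^ (δ / 2) ≤ (x : ℝ) ^ (1 - 5 / 6 : ℝ) := hmono (by linarith)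
  have hxδ4 : (x : ℝ) ^ (δ / 2) ≤ (x : ℝ) ^ (1 - 3 / 4 : ℝ) := hmono (by linarith)
  have hxδ2 : (x : ℝ) ^ (δ / 2) ≤ (x : ℝ) ^ (1 - 1 / 2 : ℝ) := hmono (by linarith)
  -- generic step: `x^a P ≤ (η/10) x` once `10 P ≤ η x^{1-a}`
  have step : ∀ {a P : ℝ}, 0 ≤ P → 10 * P ≤ η * (x : ℝ) ^ (1 - a) → (x : ℝ) ^ a * P ≤ η / 10 * x := by
    intro a P hP h
    have h0 : 0 ≤ (x : ℝ) ^ a := by positivity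
    calc (x : ℝ) ^ a * P ≤ (x : ℝ) ^ a * (η / 10 * (x : ℝ) ^ (1 - a)) :=
          mul_le_mul_of_nonneg_left (by linarith) h0
      _ = η / 10 * ((x : ℝ) ^ a * (x : ℝ) ^ (1 - a)) := by ring
      _ = η / 10 * x := by rw [← hsplit a]
  have hK15 : ∀ {c : ℝ} {m : ℕ}, c ≤ 16200 + 360 * K₀ + 240 → 0 ≤ c → m ≤ 15 →
      c * L ^ m ≤ η * (x : ℝ) ^ (δ / 2) := by
    intro c m hc hc0 hm
    have h1 : L ^ m ≤ L ^ 15 := hLp hm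
    have h2 : c * L ^ m ≤ c * L ^ 15 := mul_le_mul_of_nonneg_left h1 hc0
    have h3 : c * L ^ 15 ≤ (16200 + 360 * K₀ + 240) * L ^ 15 :=
      mul_le_mul_of_nonneg_right hc (by positivity)
    linarith
  have hKtot : (0 : ℝ) ≤ 16200 + 360 * K₀ + 240 := by positivity
  -- the nine terms (each multiplied by `L²`)
  have t1 : 24 * (x : ℝ) ^ (2 / 3 : ℝ) * L ^ 2 * L ^ 2 ≤ η / 10 * x := by
    have h1 := hK15 (c := 240) (m := 4) (by linarith) (by norm_num) (by norm_num)
    have h2 := mul_le_mul_of_nonneg_left hxδ3 hη.le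
    have h := step (a := 2 / 3) (P := 24 * L ^ 4) (by positivity) (by linarith)
    have e : 24 * (x : ℝ) ^ (2 / 3 : ℝ) * L ^ 2 * L ^ 2 = (x : ℝ) ^ (2 / 3 : ℝ) * (24 * L ^ 4) := by ring
    rw [e]; exact h
  have t2 : 24 * (x : ℝ) ^ (5 / 6 : ℝ) * L ^ 2 ≤ η / 10 * x := by
    have h1 := hK15 (c := 240) (m := 2) (by linarith) (by norm_num) (by norm_num)
    have h2 := mul_le_mul_of_nonneg_left hxδ6 hη.le
    have h := step (a := 5 / 6) (P := 24 * L ^ 2) (by positivity) (by linarith)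
    have e : 24 * (x : ℝ) ^ (5 / 6 : ℝ) * L ^ 2 = (x : ℝ) ^ (5 / 6 : ℝ) * (24 * L ^ 2) := by ring
    rw [e]; exact h
  have t3 : 12 * (x : ℝ) ^ (3 / 4 : ℝ) * L ^ 2 * L ^ 2 ≤ η / 10 * x := by
    have h1 := hK15 (c := 120) (m := 4) (by linarith) (by norm_num) (by norm_num)
    have h2 := mul_le_mul_of_nonneg_left hxδ4 hη.le
    have h := step (a := 3 / 4) (P := 12 * L ^ 4) (by positivity) (by linarith)
    have e : 12 * (x : ℝ) ^ (3 / 4 : ℝ) * L ^ 2 * L ^ 2 = (x : ℝ) ^ (3 / 4 : ℝ) * (12 * L ^ 4) := by ring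
    rw [e]; exact h
  have hηL : ∀ {c : ℝ} {m : ℕ}, 10 * c ≤ 16200 + 360 * K₀ + 240 → 0 ≤ c → 1 ≤ m →
      c * (x : ℝ) / L ^ m ≤ η / 10 * x := by
    intro c m hc hc0 hm
    have hLm : 0 < L ^ m := by positivity
    rw [div_le_iff₀ hLm]
    have h1 : L ≤ L ^ m := by
      calc L = L ^ 1 := (pow_one L).symm
        _ ≤ L ^ m := hLp hm
    have h2 : 10 * c ≤ η * L ^ m := by
      have := mul_le_mul_of_nonneg_left h1 hη.le
      linarith
    have h3 := mul_le_mul_of_nonneg_left h2 hx0.le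
    linarith
  have t4 : 4 * (4 * (x : ℝ) / L ^ 9 * L ^ 2) ≤ η / 10 * x := by
    have e : 4 * (4 * (x : ℝ) / L ^ 9 * L ^ 2) = 16 * (x : ℝ) / L ^ 7 := by
      rw [eq_div_iff (by positivity)]
      field_simp
      ring
    rw [e]; exact hηL (c := 16) (m := 7) (by linarith) (by norm_num) (by norm_num)
  have t5 : 4 * (405 * (x : ℝ) / L ^ 15 * L ^ 2) ≤ η / 10 * x := by
    have e : 4 * (405 * (x : ℝ) / L ^ 15 * L ^ 2) = 1620 * (x : ℝ) / L ^ 13 := by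
      rw [eq_div_iff (by positivity)]
      field_simp
      ring
    rw [e]; exact hηL (c := 1620) (m := 13) (by linarith) (by norm_num) (by norm_num)
  have t6 : 4 * (9 * K₀ * ((x : ℝ) / L ^ 4) * L ^ 2) ≤ η / 10 * x := by
    have e : 4 * (9 * K₀ * ((x : ℝ) / L ^ 4) * L ^ 2) = 36 * K₀ * (x : ℝ) / L ^ 2 := by
      rw [eq_div_iff (by positivity)]
      field_simp
      ring
    rw [e]; exact hηL (c := 36 * K₀) (m := 2) (by linarith) (by positivity) (by norm_num)
  have t7 : 4 * (9 * K₀ * ((x : ℝ) ^ (1 - δ / 2) * L ^ 13) * L ^ 2) ≤ η / 10 * x := by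
    have hx' : (x : ℝ) ^ (1 - (1 - δ / 2)) = (x : ℝ) ^ (δ / 2) := by
      congr 1; ring
    have h1 := hK15 (c := 360 * K₀) (m := 15) (by linarith) (by positivity) le_rfl
    have h := step (a := 1 - δ / 2) (P := 36 * K₀ * L ^ 15) (by positivity) (by rw [hx']; linarith)
    have e : 4 * (9 * K₀ * ((x : ℝ) ^ (1 - δ / 2) * L ^ 13) * L ^ 2) =
        (x : ℝ) ^ (1 - δ / 2) * (36 * K₀ * L ^ 15) := by ring
    rw [e]; exact h
  have t8 : 4 * (3 * (x : ℝ) ^ (1 / 2 : ℝ) * L * L ^ 2) ≤ η / 10 * x := by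
    have h1 := hK15 (c := 120) (m := 3) (by linarith) (by norm_num) (by norm_num)
    have h2 := mul_le_mul_of_nonneg_left hxδ2 hη.le
    have h := step (a := 1 / 2) (P := 12 * L ^ 3) (by positivity) (by linarith)
    have e : 4 * (3 * (x : ℝ) ^ (1 / 2 : ℝ) * L * L ^ 2) = (x : ℝ) ^ (1 / 2 : ℝ) * (12 * L ^ 3) := by ring
    rw [e]; exact h
  have t9 : 8 * (x : ℝ) ^ (1 - ε) * L * L ^ 2 ≤ η / 10 * x := by
    have hx' : (x : ℝ) ^ (1 - (1 - ε)) = (x : ℝ) ^ ε := by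
      congr 1; ring
    have h3 : 80 * L ^ 3 ≤ (16200 + 360 * K₀ + 240) * L ^ 3 :=
      mul_le_mul_of_nonneg_right (by linarith) (by positivity)
    have h := step (a := 1 - ε) (P := 8 * L ^ 3) (by positivity) (by rw [hx']; linarith)
    have e : 8 * (x : ℝ) ^ (1 - ε) * L * L ^ 2 = (x : ℝ) ^ (1 - ε) * (8 * L ^ 3) := by ring
    rw [e]; exact h
  -- sum up
  rw [le_div_iff₀ hL2]
  have hsum : (4 * (6 * (x : ℝ) ^ (2 / 3 : ℝ) * L ^ 2 + 6 * (x : ℝ) ^ (5 / 6 : ℝ) +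
      3 * (x : ℝ) ^ (3 / 4 : ℝ) * L ^ 2 + 4 * (x : ℝ) / L ^ 9 + 405 * (x : ℝ) / L ^ 15 +
      9 * K₀ * ((x : ℝ) / L ^ 4) + 9 * K₀ * ((x : ℝ) ^ (1 - δ / 2) * L ^ 13) +
      3 * (x : ℝ) ^ (1 / 2 : ℝ) * L) + 8 * (x : ℝ) ^ (1 - ε) * L) * L ^ 2 =
      24 * (x : ℝ) ^ (2 / 3 : ℝ) * L ^ 2 * L ^ 2 + 24 * (x : ℝ) ^ (5 / 6 : ℝ) * L ^ 2 +
      12 * (x : ℝ) ^ (3 / 4 : ℝ) * L ^ 2 * L ^ 2 + 4 * (4 * (x : ℝ) / L ^ 9 * L ^ 2) +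
      4 * (405 * (x : ℝ) / L ^ 15 * L ^ 2) + 4 * (9 * K₀ * ((x : ℝ) / L ^ 4) * L ^ 2) +
      4 * (9 * K₀ * ((x : ℝ) ^ (1 - δ / 2) * L ^ 13) * L ^ 2) +
      4 * (3 * (x : ℝ) ^ (1 / 2 : ℝ) * L * L ^ 2) + 8 * (x : ℝ) ^ (1 - ε) * L * L ^ 2 := by ring
  rw [hsum]
  have : 0 ≤ η / 10 * (x : ℝ) := by positivity
  linarith [t1, t2, t3, t4, t5, t6, t7, t8, t9]

end Summit.Parity.GeneralizedHardyLittlewood.Theorems
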